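import Literature.MathematicalPhysics.QuantumLattice.SpinChargeKinematics
import Literature.MathematicalPhysics.QuantumLattice.HubbardCouplingTransport
import HarnessLib

/-!
# Second quantisation of site injections for quantum SPIN systems: `𝔄_X → 𝔄_Y` along `φ : X ↪ Y`

Family `hubbard` (topic `MathematicalPhysics/QuantumLattice`). The spin-system counterpart of the
fermionic `fermionEmbed` (InfVolFermionState): for an injection of sites `φ : X ↪ Y` the unital
`*`-homomorphism `spinEmbed φ : 𝔄_X = B(⊗_{x∈X} ℂ^q) → 𝔄_Y`, `A ↦ A ⊗ 𝟙_{Y ∖ φ(X)}` with the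
tensor legs relabelled along `φ` (Bratteli–Robinson II §6.2.1: isotony and covariance of the local
structure `Λ ↦ 𝔄_Λ` of a quantum spin system). It is the tree's `localOp` on the range of `φ`
composed with the relabelling `reindexOp` (`SpinSystem`), packaged as an algebra homomorphism, with:
the entry formula (`spinEmbed_apply`), functoriality (`spinEmbed_spinEmbed`), bijections act as
`reindexOp` (`spinEmbed_equiv`) hence as conjugation by the permutation unitaries `permOp`
(`permOp_conj_spinEmbed`), single-site operators and spins are moved to the image site
(`spinEmbed_onSite`, `spinEmbed_siteSpin`, `spinEmbed_spinDot`), `*`-compatibility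
(`spinEmbed_conjTranspose`), support on the range and commutation of operators embedded along
injections with disjoint ranges (`isSupportedOn_spinEmbed`, `spinEmbed_commute_of_disjoint`).
These are the bookkeeping facts used to pull a "window" identity of the quasi-local spin algebra of
`ℤ^d` back into every large torus (`HeisenbergWindowCertificate`). Everything is PROVED; the
definitions are `localOpAlgHom` (the tree's `localOp` as an algebra hom) and `spinEmbed`.

## References
* O. Bratteli, D. W. Robinson, *Operator Algebras and Quantum Statistical Mechanics II*, 2nd ed.
  (Springer 1997), §6.2.1 (quantum spin systems: `𝔄_Λ = ⊗_{x∈Λ} M_q`, isotony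
  `𝔄_{Λ₁} ↪ 𝔄_{Λ₂}`, local commutativity, covariance under lattice symmetries).
  [cite: BratteliRobinsonII1997, §6.2.1]
* B. Nachtergaele, R. Sims, *Lieb–Robinson bounds and the exponential clustering theorem*,
  Comm. Math. Phys. 265 (2006) 119, §2 (set-up `𝒜_X ⊆ 𝒜_Λ`). [cite: NachtergaeleSims2006, §2]
-/

noncomputable section

namespace Literature.MathematicalPhysics.QuantumLattice

open Matrix Finset

section LocalOpHom

variable {Y : Type*} [Fintype Y] [DecidableEq Y] {q : ℕ}

/-- **`A ↦ A ⊗ 𝟙_{Y∖S}` as a unital algebra homomorphism** `𝔄_S → 𝔄_Y` (the tree's `localOp S`,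
with `localOp_one/_mul/_add/_smul`). [cite: BratteliRobinsonII1997, §6.2.1] -/
def localOpAlgHom (S : Finset Y) : Matrix (S → Fin q) (S → Fin q) ℂ →ₐ[ℂ] Op Y q where
  toFun := localOp S
  map_one' := localOp_one S
  map_mul' := localOp_mul_holds S
  map_zero' := localOp_zero S
  map_add' := localOp_add S
  commutes' c := by
    rw [Algebra.algebraMap_eq_smul_one, Algebra.algebraMap_eq_smul_one, localOp_smul, localOp_one]

/-- `localOpAlgHom S A = localOp S A` (definitional). [folklore] -/
@[simp] theorem localOpAlgHom_apply (S : Finset Y) (A : Matrix (S → Fin q) (S → Fin q) ℂ) :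
    localOpAlgHom S A = localOp S A := rfl

end LocalOpHom

section Embed

variable {X Y Z : Type*} [Fintype X] [DecidableEq X] [Fintype Y] [DecidableEq Y]
  [Fintype Z] [DecidableEq Z] {q : ℕ}

/-- **Second quantisation of a site injection for spin systems**: `spinEmbed φ : 𝔄_X →ₐ 𝔄_Y`,
`A ↦ (A relabelled along φ) ⊗ 𝟙_{Y ∖ φ(X)}` — `localOp` on the range `rangeSites φ` of the operator
transported along the bijection `rangeEquiv φ : X ≃ φ(X)`. [cite: BratteliRobinsonII1997, §6.2.1] -/
def spinEmbed (φ : X ↪ Y) : Op X q →ₐ[ℂ] Op Y q :=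
  (localOpAlgHom (rangeSites φ)).comp (reindexOp (q := q) (rangeEquiv φ)).toAlgHom

/-- `spinEmbed φ A = localOp (rangeSites φ) (reindexOp (rangeEquiv φ) A)` (definitional). [folklore] -/
theorem spinEmbed_eq_localOp (φ : X ↪ Y) (A : Op X q) :
    spinEmbed φ A = localOp (rangeSites φ) (reindexOp (rangeEquiv φ) A) := rfl

omit [DecidableEq X] [Fintype Y] [DecidableEq Y] in
/-- Membership in the range of `φ`, as a finite set and as a set. [folklore] -/
theorem mem_rangeSites_iff (φ : X ↪ Y) (y : Y) : y ∈ rangeSites φ ↔ y ∈ Set.range φ := by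
  simp [rangeSites, Finset.mem_map, Set.mem_range]

/-- **Entries of `spinEmbed φ A`**: `⟨σ| Γ_φ A |τ⟩ = A (σ ∘ φ) (τ ∘ φ)` if `σ = τ` off the range of
`φ`, and `0` otherwise. [cite: BratteliRobinsonII1997, §6.2.1] -/
theorem spinEmbed_apply (φ : X ↪ Y) (A : Op X q) (σ τ : TensorIndex Y q) :
    spinEmbed φ A σ τ =
      if (∀ y, y ∉ Set.range φ → σ y = τ y) then A (fun x => σ (φ x)) (fun x => τ (φ x)) else 0 := by
  rw [spinEmbed_eq_localOp, localOp_apply, reindexOp_apply]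
  have hc : (∀ y, y ∉ rangeSites φ → σ y = τ y) ↔ (∀ y, y ∉ Set.range φ → σ y = τ y) :=
    forall_congr' fun y => by rw [mem_rangeSites_iff]
  rw [if_congr hc rfl rfl]
  rfl

/-- **Functoriality**: `Γ_ψ (Γ_φ A) = Γ_{ψ ∘ φ} A`. [cite: BratteliRobinsonII1997, §6.2.1] -/
theorem spinEmbed_spinEmbed (φ : X ↪ Y) (ψ : Y ↪ Z) (A : Op X q) :
    spinEmbed ψ (spinEmbed φ A) = spinEmbed (φ.trans ψ) A := by
  ext σ τ
  simp only [spinEmbed_apply, Function.Embedding.trans_apply]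
  by_cases h : ∀ z, z ∉ Set.range (φ.trans ψ) → σ z = τ z
  · have h1 : ∀ z, z ∉ Set.range ψ → σ z = τ z :=
      fun z hz => h z fun ⟨x, hx⟩ => hz ⟨φ x, hx⟩
    have h2 : ∀ y, y ∉ Set.range φ → σ (ψ y) = τ (ψ y) :=
      fun y hy => h (ψ y) fun ⟨x, hx⟩ => hy ⟨x, ψ.injective hx⟩
    rw [if_pos h, if_pos h1, if_pos h2]
  · rw [if_neg h]
    by_cases h1 : ∀ z, z ∉ Set.range ψ → σ z = τ z
    · rw [if_pos h1, if_neg]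
      intro h2
      refine h fun z hz => ?_
      by_cases hzψ : z ∈ Set.range ψ
      · obtain ⟨y, rfl⟩ := hzψ
        exact h2 y fun ⟨x, hx⟩ => hz ⟨x, by rw [Function.Embedding.trans_apply, hx]⟩
      · exact h1 z hzψ
    · rw [if_neg h1]

/-- **Along a bijection `Γ` is the relabelling isomorphism** `reindexOp`. [cite: BratteliRobinsonII1997, §6.2.1] -/
theorem spinEmbed_equiv (e : X ≃ Y) (A : Op X q) : spinEmbed e.toEmbedding A = reindexOp e A := by
  ext σ τ
  rw [spinEmbed_apply, reindexOp_apply, if_pos]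
  · rfl
  · intro y hy
    exact absurd ⟨e.symm y, by simp⟩ hy

/-- `Γ_{id} = id`. [folklore] -/
theorem spinEmbed_refl (A : Op X q) : spinEmbed (Function.Embedding.refl X) A = A := by
  ext σ τ
  rw [spinEmbed_apply, if_pos]
  · rfl
  · intro y hy
    exact absurd ⟨y, rfl⟩ hy

/-- **Covariance**: conjugating an embedded operator by the permutation unitary of a site bijection
`e` of `Y` re-embeds it along `e ∘ φ`: `P_e (Γ_φ A) P_eᴴ = Γ_{e∘φ} A`.
[cite: BratteliRobinsonII1997, §6.2.1] -/
theorem permOp_conj_spinEmbed (e : Y ≃ Y) (φ : X ↪ Y) (A : Op X q) :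
    permOp e * spinEmbed φ A * (permOp e)ᴴ = spinEmbed (φ.trans e.toEmbedding) A := by
  rw [permOp_mul_mul_conjTranspose, ← spinEmbed_equiv, spinEmbed_spinEmbed]

/-- **`Γ_φ` moves single-site operators to the image site**: `Γ_φ (𝟙 ⊗ a_x ⊗ 𝟙) = 𝟙 ⊗ a_{φ x} ⊗ 𝟙`.
[cite: BratteliRobinsonII1997, §6.2.1] -/
theorem spinEmbed_onSite (φ : X ↪ Y) (x : X) (a : Matrix (Fin q) (Fin q) ℂ) :
    spinEmbed φ (onSite x a : Op X q) = onSite (φ x) a := by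
  ext σ τ
  rw [spinEmbed_apply, onSite_apply, onSite_apply]
  by_cases h : ∀ y, y ≠ φ x → σ y = τ y
  · rw [if_pos h, if_pos, if_pos]
    · exact fun x' hx' => h (φ x') fun hh => hx' (φ.injective hh)
    · exact fun y hy => h y fun hh => hy ⟨x, hh.symm⟩
  · rw [if_neg h]
    by_cases h1 : ∀ y, y ∉ Set.range φ → σ y = τ y
    · rw [if_pos h1, if_neg]
      intro h2
      refine h fun y hy => ?_
      by_cases hyφ : y ∈ Set.range φ
      · obtain ⟨x', rfl⟩ := hyφ
        exact h2 x' fun hh => hy (congrArg φ hh)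
      · exact h1 y hyφ
    · rw [if_neg h1]

/-- `Γ_φ (S^α_x) = S^α_{φ x}`. [cite: BratteliRobinsonII1997, §6.2.1] -/
theorem spinEmbed_siteSpin (φ : X ↪ Y) (n : ℕ) (x : X) (α : Fin 3) :
    spinEmbed φ (siteSpin n x α : Op X (n + 1)) = siteSpin n (φ x) α :=
  spinEmbed_onSite φ x _

/-- `Γ_φ (𝐒_x · 𝐒_y) = 𝐒_{φ x} · 𝐒_{φ y}`. [cite: BratteliRobinsonII1997, §6.2.1] -/
theorem spinEmbed_spinDot (φ : X ↪ Y) (n : ℕ) (x y : X) :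
    spinEmbed φ (spinDot n x y) = spinDot n (φ x) (φ y) := by
  simp only [spinDot, spinBond, map_sum, map_smul, map_add, map_mul, spinEmbed_siteSpin]

/-- Relabelling commutes with the adjoint. [folklore] -/
theorem reindexOp_conjTranspose_eq (e : X ≃ Y) (A : Op X q) :
    reindexOp e Aᴴ = (reindexOp e A)ᴴ := by
  ext σ τ
  rfl

/-- **`Γ_φ` is a `*`-map**: `Γ_φ (Aᴴ) = (Γ_φ A)ᴴ`. [cite: BratteliRobinsonII1997, §6.2.1] -/
theorem spinEmbed_conjTranspose (φ : X ↪ Y) (A : Op X q) :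
    spinEmbed φ Aᴴ = (spinEmbed φ A)ᴴ := by
  rw [spinEmbed_eq_localOp, spinEmbed_eq_localOp, reindexOp_conjTranspose_eq, localOp_conjTranspose]

/-- `Γ_φ A` is supported on the range of `φ`. [cite: NachtergaeleSims2006, §2] -/
theorem isSupportedOn_spinEmbed (φ : X ↪ Y) (A : Op X q) :
    IsSupportedOn (spinEmbed φ A) (rangeSites φ) :=
  ⟨_, rfl⟩

/-- **Local commutativity**: an operator embedded along `φ` commutes with every operator supported
away from the range of `φ`. [cite: BratteliRobinsonII1997, §6.2.1] -/
theorem spinEmbed_commute_of_disjoint (φ : X ↪ Y) (A : Op X q) {B : Op Y q} {T : Finset Y}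
    (hB : IsSupportedOn B T) (h : Disjoint (rangeSites φ) T) : Commute (spinEmbed φ A) B :=
  commute_of_disjoint_holds (isSupportedOn_spinEmbed φ A) hB h

/-- Operators embedded along injections with disjoint ranges commute. [cite: BratteliRobinsonII1997, §6.2.1] -/
theorem spinEmbed_commute_spinEmbed (φ : X ↪ Y) (ψ : Z ↪ Y) (A : Op X q) (B : Op Z q)
    (h : Disjoint (rangeSites φ) (rangeSites ψ)) : Commute (spinEmbed φ A) (spinEmbed ψ B) :=
  spinEmbed_commute_of_disjoint φ A (isSupportedOn_spinEmbed ψ B) h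

end Embed

end Literature.MathematicalPhysics.QuantumLattice
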